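import Summits.BirchSwinnertonDyer.Rank1Residual.F1Sign2.CongruenceLocalGaugeAtTwo
import Mathlib.RingTheory.Discriminant

/-!
# Cell `bsd-f1-sign2` — PROOFS for `F1Sign2/CongruenceLocalGaugeAtTwo.lean` (p616822): **DESC-§21-D `DiscProductSquareOfTwoCongruence` HOLDS**,
# via the discriminant of the cubic `2`-division algebra `L_W = ℚ[u]/(c_W)`: `N(c_W′(θ_W)) = −2⁸Δ_W`, `disc(1, θ_W, θ_W²) = 2⁸Δ_W`

Typer seat `bsd-f1-sign2-ty` g8, 2026-08-28 (CANDIDATES.md row DESC-§21-D; REF1-AUDIT §83: «D TRUE (elementary), CLEARED as support; disc c_W =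
2⁸·Δ_W exactly»; REF2-PLACEMENT v19 §2: «D = KNOWN, folklore (isomorphic irreducible cubic étale algebras ⇒ Δ_EΔ_F ∈ ℚ^{×2})»). The row was filed
as a plain `def … : Prop` in the statement module (296 lines, carries proofs, capped at 400), so its proof lives in this sibling `…Proofs` module,
which imports it and restates nothing. No new `Prop` row, no named Literature fact, no `sorry`; one auxiliary DEFINITION with a body (`twoDivisionCubicBasis W`,
the power basis `1, θ_W, θ_W²` of `L_W` re-indexed by `Fin 3`) and theorems.

PROOF (folklore; Lean route chosen by the typer). (1) `twoDivisionRoot_cube`, `twoDivisionDifferent_eq`, `twoDivisionDifferent_mul_root(_sq)`: the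
cubic relation `θ³ = −b₂θ² − 8b₄θ − 16b₆` and the reductions of `c_W′(θ)·θ^j` (`c_W = X³ + b₂X² + 8b₄X + 16b₆`, `c_W′(θ) = 3θ² + 2b₂θ + 8b₄`), stated
OUTSIDE the `Fact (Irreducible c_W)` sections so that every scalar is the `AdjoinRoot` algebra map. (2) `leftMulMatrix_twoDivisionDifferent`: the
matrix of multiplication by `c_W′(θ)` on `1, θ, θ²` is `!![8b₄, −48b₆, 16b₂b₆; 2b₂, −16b₄, 8b₂b₄ − 48b₆; 3, −b₂, b₂² − 16b₄]`. (3) `norm_twoDivisionDifferent`: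
its determinant is `−2⁸Δ_W` (`Matrix.det_fin_three` + `ring` after unfolding `Δ, b₂, b₄, b₆, b₈` — the identity `4b₈ = b₂b₆ − b₄²` is absorbed by
writing everything in `a₁,…,a₆`), i.e. `N_{L_W/ℚ}(c_W′(θ_W)) = −disc(c_W) = −2⁸Δ_W`. (4) `discr_twoDivisionCubicBasis`: Mathlib's `Algebra.discr_powerBasis_eq_norm`
(`disc = (−1)^{n(n−1)/2} N(f′(θ))`, `n = 3`) gives `disc(1,θ,θ²) = 2⁸Δ_W`; the `ℚ`-algebra structure on the field `L_W` coming from `Field` (`DivisionRing.toRatAlgebra`)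
and the `AdjoinRoot` one are identified by `Subsingleton (Algebra ℚ _)`. (5) `discProductSquareOfTwoCongruence_holds`: along `φ : L_F ≃ₐ[ℚ] L_E` the
discriminant is invariant (`Algebra.discr_eq_discr_of_algEquiv`) and changes by `det(P)²` under the rational base change `P` from `1,θ_E,θ_E²` to
`φ(1),φ(θ_F),φ(θ_F²)` (`Basis.toMatrix_map_vecMul`, `Algebra.discr_of_matrix_vecMul`), so `2⁸Δ_F = det(P)²·2⁸Δ_E` and `Δ_E·Δ_F = (det P·Δ_E)²`.
Only the irreducibility `Fact`s of the row are used (to make `L_W` a field for step (4)); steps (1)–(3) hold for every Weierstrass curve over `ℚ`.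
[folklore] Prior art for the shape of (4) in the tree: `Summits/Ventures/PQCStructure/Ladder/TraceFormDiscriminant.lean` (`discr_eq_norm_derivative`,
any commutative base ring) — not imported here (cross-summit); Mathlib's field version suffices.
-/

noncomputable section

open Polynomial WeierstrassCurve Module

namespace Summit.BirchSwinnertonDyer.Rank1Residual.F1Sign2

/-- The cubic relation `θ³ + b₂θ² + 8b₄θ + 16b₆ = 0` in `L_W`. -/
theorem twoDivisionRoot_cube (W : WeierstrassCurve ℚ) :
    twoDivisionRoot W ^ 3 + algebraMap ℚ _ W.b₂ * twoDivisionRoot W ^ 2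
      + 8 * algebraMap ℚ _ W.b₄ * twoDivisionRoot W + 16 * algebraMap ℚ _ W.b₆ = 0 := by
  have h0 := aeval_twoDivisionRoot_twoDivisionUCubic W
  simp only [twoDivisionUCubic, map_add, map_mul, map_pow, map_ofNat, aeval_C, aeval_X] at h0
  linear_combination h0

/-- `c_W′(θ_W) = 3θ² + 2b₂θ + 8b₄`. -/
theorem twoDivisionDifferent_eq (W : WeierstrassCurve ℚ) :
    twoDivisionDifferent W = 3 * twoDivisionRoot W ^ 2 + 2 * algebraMap ℚ _ W.b₂ * twoDivisionRoot W
      + 8 * algebraMap ℚ _ W.b₄ := by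
  unfold twoDivisionDifferent
  rw [derivative_twoDivisionUCubic]
  simp only [map_add, map_mul, map_pow, map_ofNat, aeval_C, aeval_X]

/-- `c_W′(θ)·θ² = 16b₂b₆ + (8b₂b₄ − 48b₆)θ + (b₂² − 16b₄)θ²` (reduction by the cubic relation; stated outside the `Fact` section
so that every `algebraMap ℚ L_W` is the `AdjoinRoot` one). -/
theorem twoDivisionDifferent_mul_root_sq (W : WeierstrassCurve ℚ) :
    twoDivisionDifferent W * twoDivisionRoot W ^ 2 =
      16 * (algebraMap ℚ _ W.b₂ * algebraMap ℚ _ W.b₆)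
        + (8 * (algebraMap ℚ _ W.b₂ * algebraMap ℚ _ W.b₄) - 48 * algebraMap ℚ _ W.b₆) * twoDivisionRoot W
        + (algebraMap ℚ _ W.b₂ ^ 2 - 16 * algebraMap ℚ _ W.b₄) * twoDivisionRoot W ^ 2 := by
  rw [twoDivisionDifferent_eq]
  linear_combination (3 * twoDivisionRoot W - algebraMap ℚ _ W.b₂) * twoDivisionRoot_cube W

/-- `c_W′(θ)·θ = −48b₆ − 16b₄θ − b₂θ²`. -/
theorem twoDivisionDifferent_mul_root (W : WeierstrassCurve ℚ) :
    twoDivisionDifferent W * twoDivisionRoot W =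
      -(48 * algebraMap ℚ _ W.b₆) + -(16 * algebraMap ℚ _ W.b₄) * twoDivisionRoot W
        + -algebraMap ℚ _ W.b₂ * twoDivisionRoot W ^ 2 := by
  rw [twoDivisionDifferent_eq]
  linear_combination (3 : twoDivisionAlgebra W) * twoDivisionRoot_cube W

section NormComputation

variable (W : WeierstrassCurve ℚ) [Fact (Irreducible (twoDivisionUCubic W))]

/-- The power basis `1, θ, θ²` of `L_W`, indexed by `Fin 3`. -/
def twoDivisionCubicBasis : Basis (Fin 3) ℚ (twoDivisionAlgebra W) :=
  (AdjoinRoot.powerBasis (twoDivisionUCubic_monic W).ne_zero).basis.reindex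
    (finCongr (by rw [AdjoinRoot.powerBasis_dim, twoDivisionUCubic_natDegree]))

/-- `twoDivisionCubicBasis W i = θ_W ^ i`. -/
theorem twoDivisionCubicBasis_apply (i : Fin 3) : twoDivisionCubicBasis W i = twoDivisionRoot W ^ (i : ℕ) := by
  simp [twoDivisionCubicBasis, PowerBasis.coe_basis, AdjoinRoot.powerBasis_gen]

/-- The multiplication matrix of `c_W′(θ_W)` on `1, θ, θ²`. -/
theorem leftMulMatrix_twoDivisionDifferent :
    Algebra.leftMulMatrix (twoDivisionCubicBasis W) (twoDivisionDifferent W) =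
      !![8 * W.b₄, -48 * W.b₆, 16 * W.b₂ * W.b₆;
         2 * W.b₂, -16 * W.b₄, 8 * W.b₂ * W.b₄ - 48 * W.b₆;
         3, -W.b₂, W.b₂ ^ 2 - 16 * W.b₄] := by
  have hd := twoDivisionDifferent_eq W
  -- the three columns as ℚ-combinations of the basis
  have e0 : twoDivisionDifferent W * twoDivisionCubicBasis W 0 =
      (8 * W.b₄) • twoDivisionCubicBasis W 0 + (2 * W.b₂) • twoDivisionCubicBasis W 1 + (3 : ℚ) • twoDivisionCubicBasis W 2 := by
    simp only [twoDivisionCubicBasis_apply, Algebra.smul_def, map_mul, map_ofNat, Fin.val_zero, Fin.val_one, Fin.val_two,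
      pow_zero, pow_one, mul_one]
    rw [hd]; ring
  have e1 : twoDivisionDifferent W * twoDivisionCubicBasis W 1 =
      (-48 * W.b₆) • twoDivisionCubicBasis W 0 + (-16 * W.b₄) • twoDivisionCubicBasis W 1 + (-W.b₂) • twoDivisionCubicBasis W 2 := by
    simp only [twoDivisionCubicBasis_apply, Algebra.smul_def, map_mul, map_neg, map_ofNat, Fin.val_zero, Fin.val_one, Fin.val_two,
      pow_zero, pow_one, mul_one]
    rw [twoDivisionDifferent_mul_root]; ring
  have e2 : twoDivisionDifferent W * twoDivisionCubicBasis W 2 =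
      (16 * W.b₂ * W.b₆) • twoDivisionCubicBasis W 0 + (8 * W.b₂ * W.b₄ - 48 * W.b₆) • twoDivisionCubicBasis W 1
        + (W.b₂ ^ 2 - 16 * W.b₄) • twoDivisionCubicBasis W 2 := by
    simp only [twoDivisionCubicBasis_apply, Algebra.smul_def, map_mul, map_sub, map_pow, map_ofNat, Fin.val_zero, Fin.val_one,
      Fin.val_two, pow_zero, pow_one, mul_one]
    rw [twoDivisionDifferent_mul_root_sq]; ring
  ext i j
  rw [Algebra.leftMulMatrix_eq_repr_mul]
  fin_cases i <;> fin_cases j <;>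
    simp [e0, e1, e2]

/-- **`N_{L_W/ℚ}(c_W′(θ_W)) = −2⁸·Δ_W`** (the norm of the different of `θ_W` is minus the discriminant of the `u`-cubic
`X³ + b₂X² + 8b₄X + 16b₆`, which is `2⁸ Δ_W` by `4b₈ = b₂b₆ − b₄²`). -/
theorem norm_twoDivisionDifferent : Algebra.norm ℚ (twoDivisionDifferent W) = -(256 * W.Δ) := by
  rw [Algebra.norm_eq_matrix_det (twoDivisionCubicBasis W), leftMulMatrix_twoDivisionDifferent, Matrix.det_fin_three]
  simp only [Matrix.of_apply, Matrix.cons_val', Matrix.cons_val_zero, Matrix.cons_val_one, Matrix.cons_val_two,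
    Matrix.empty_val', Matrix.cons_val_fin_one, Matrix.vecHead, Matrix.vecTail, Function.comp_apply,
    Fin.succ_zero_eq_one]
  simp only [WeierstrassCurve.Δ, WeierstrassCurve.b₂, WeierstrassCurve.b₄, WeierstrassCurve.b₆, WeierstrassCurve.b₈]
  ring

/-- **`disc(1, θ_W, θ_W²) = 2⁸·Δ_W`**: the discriminant of the power basis of the cubic field `L_W = ℚ(θ_W)`. -/
theorem discr_twoDivisionCubicBasis : Algebra.discr ℚ ⇑(twoDivisionCubicBasis W) = 256 * W.Δ := by
  haveI : FiniteDimensional ℚ (twoDivisionAlgebra W) := finiteDimensional_twoDivisionAlgebra W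
  have hdisc := Algebra.discr_powerBasis_eq_norm ℚ (AdjoinRoot.powerBasis (twoDivisionUCubic_monic W).ne_zero)
  rw [finrank_twoDivisionAlgebra, AdjoinRoot.minpoly_powerBasis_gen_of_monic (twoDivisionUCubic_monic W),
    AdjoinRoot.powerBasis_gen] at hdisc
  change Algebra.discr ℚ _ = (-1) ^ (3 * (3 - 1) / 2) * Algebra.norm ℚ (twoDivisionDifferent W) at hdisc
  rw [norm_twoDivisionDifferent] at hdisc
  norm_num at hdisc
  -- `hdisc` is stated with the `AdjoinRoot` algebra instance, the goal with the `Field`-derived one (`ℚ`-algebra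
  -- structures form a subsingleton); bridge the two.
  unfold twoDivisionCubicBasis
  rw [Basis.coe_reindex, Algebra.discr_reindex]
  convert hdisc using 2
  all_goals first | rfl | exact Subsingleton.elim _ _ | simp [PowerBasis.coe_basis, AdjoinRoot.powerBasis_gen]

end NormComputation

/-- **DESC-§21-D holds** (REF1-AUDIT §83: TRUE, elementary; REF2 v19 §2: folklore): two curves with isomorphic irreducible cubic
`2`-division algebras have `Δ_E · Δ_F ∈ ℚ^{×2}` — the discriminants of the two power bases are `2⁸Δ_E`, `2⁸Δ_F`
(`discr_twoDivisionCubicBasis`) and differ by the square of the determinant of the base-change matrix along the isomorphism. -/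
theorem discProductSquareOfTwoCongruence_holds : DiscProductSquareOfTwoCongruence := by
  intro E F _ _ hφ
  obtain ⟨φ⟩ := hφ
  -- the transported basis of `L_F` inside `L_E`
  let v : Fin 3 → twoDivisionAlgebra E := φ ∘ twoDivisionCubicBasis F
  have hv : Algebra.discr ℚ v = 256 * F.Δ := by
    rw [← discr_twoDivisionCubicBasis F]
    exact (Algebra.discr_eq_discr_of_algEquiv (twoDivisionCubicBasis F) φ).symm
  let P : Matrix (Fin 3) (Fin 3) ℚ := (twoDivisionCubicBasis E).toMatrix v
  have hP : Algebra.discr ℚ v = P.det ^ 2 * Algebra.discr ℚ ⇑(twoDivisionCubicBasis E) := by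
    rw [← Algebra.discr_of_matrix_vecMul, Basis.toMatrix_map_vecMul]
  rw [discr_twoDivisionCubicBasis E, hv] at hP
  refine ⟨P.det * E.Δ, ?_⟩
  have hF : F.Δ = P.det ^ 2 * E.Δ := by linarith [hP]
  rw [hF]; ring

end Summit.BirchSwinnertonDyer.Rank1Residual.F1Sign2

end
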